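import Literature.NumberTheory.Sieve.Maynard2016Theorem1OfLemma7Tuple
import Literature.NumberTheory.Sieve.Maynard2016Lemma7PairBound
import Literature.NumberTheory.Sieve.Maynard2016Lemma7ClassMoment

/-!
# Maynard (2016), Theorem 1 — unconditional

Trunk: AntSieve / parity (Maynard 2016 large-gaps ladder).

J. Maynard, *Large gaps between primes*, Ann. of Math. 183 (2016) = arXiv:1408.5110.  The two named
inputs of `lemma7Tuple_of_parts` are theorems of the tree: the main-term lower bound
`lemma7MainLower_holds` (`Maynard2016Lemma7PairBound`) and the congruence-class moment
`lemma7ClassMoment_holds` (`Maynard2016Lemma7ClassMoment`).  Hence Lemma 7 (`Lemma7Tuple`), and with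
Lemma 6 (`maynard2016_lemma6_holds`), Lemma 8, Lemmas 2–3, Proposition 5′ and the §2 reduction
(`theorem1_of_lemma7Tuple`), **Theorem 1** as printed:
`limsup_n (p_{n+1} − p_n) / (log p_n · log₂ p_n · log₄ p_n · (log₃ p_n)^{−2}) = ∞`
(`Maynard2016_theorem1`), i.e. Rankin's bound `G(X) ≥ (c − o(1)) log X log₂ X log₄ X/(log₃ X)²`
with an ARBITRARY constant `c` (`RankinConstant c` for every `c`; Erdős's question).  This file
records the three corollaries; no named fact of the Maynard 2016 ladder remains.

## References

* J. Maynard, *Large gaps between primes*, Ann. of Math. (2) 183 (2016), 915–933; arXiv:1408.5110,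
  Theorem 1, Lemma 7. [Maynard2016LargeGaps]
-/

namespace Literature.NumberTheory.Sieve

namespace Maynard2016

/-- **Lemma 7 of Maynard (2016)** (per-tuple form, displays (6.23)–(6.31), (6.33)), unconditionally.
[cite: Maynard2016LargeGaps, Lemma 7] -/
theorem lemma7Tuple_holds : Lemma7Tuple :=
  lemma7Tuple_of_parts lemma7MainLower_holds lemma7ClassMoment_holds

/-- **Theorem 1 of Maynard (2016)**, unconditionally: for every `t`,
`p_{n+1} − p_n ≥ t · log p_n log₂ p_n log₄ p_n / (log₃ p_n)²` for infinitely many `n`.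
[cite: Maynard2016LargeGaps, Theorem 1] -/
theorem maynard2016_theorem1 : Literature.NumberTheory.Sieve.Maynard2016_theorem1 :=
  theorem1_of_lemma7Tuple lemma7Tuple_holds

/-- **Rankin's bound with an arbitrary constant** (Erdős's question), unconditionally.
[cite: Maynard2016LargeGaps, Theorem 1] -/
theorem rankinConstant_all (c : ℝ) : Literature.NumberTheory.Sieve.RankinConstant c :=
  forall_rankinConstant_of_lemma7Tuple lemma7Tuple_holds c

/-- `RankinConstant` holds for all parameters — `_holds` alias of `rankinConstant_all` above under the fact's exact name
(appended 2026-08-28, D-0026 bookkeeping: the proof term is the existing theorem of this file; no statement,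
definition or attribute is edited; no new named fact; the ledger's debt table listed the fact
unproved). [cite: Maynard2016LargeGaps, Theorem 1] -/
theorem _root_.Literature.NumberTheory.Sieve.RankinConstant_holds (c : ℝ) :
    Literature.NumberTheory.Sieve.RankinConstant c :=
  _root_.Literature.NumberTheory.Sieve.Maynard2016.rankinConstant_all c

end Maynard2016

end Literature.NumberTheory.Sieve
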